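import Mathlib
import HarnessLib
import HarnessLib.Audit
import Summits.SmoothPoincare4.Statement
import Literature.Topology.FourManifolds.HomotopySpheres
import Literature.Topology.FourManifolds.Morse
import Literature.Topology.FourManifolds.RegularLevelSet
import Literature.Topology.FourManifolds.HomotopyS4CompactProofs
import Literature.Topology.FourManifolds.HomotopyS4OrientableProofs
import HarnessLib.Audit.Status.Attr

/-!
Route: LensThinSweepouts

DORMANT since 2026-08-22T14:21:37Z (reconciler: no traction for 5.4 d (last activity item-evidence-added at 2026-08-17T04:13:38Z); parked, not closed — `ledger route dormant route-SmoothPoincare4-LensThinSweepouts --off` to reactivate) — unstaffed, not closed; items shared with open routes are served there. `ledger route dormant <id> --off` reactivates.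

# Route LensThinSweepouts — level-genus width of sweepouts — no fake 4-sphere is swept by lens
spaces

It suffices to show X = R2 ∧ E2 (card lens-thin-sweepouts, spine and only card). Grade a homotopy
4-sphere Σ by the LEVEL-GENUS
WIDTH of a sweepout: for a Morse function f : Σ → ℝ with pairwise distinct critical values, w(f) =
max over regular values t of the
total Heegaard genus of the closed 3-manifold f⁻¹(t) (encoded as: f⁻¹(t) carries a Morse function
with at most w critical points of
index 1), and w(Σ) = min_f w(f); w(S⁴) = 0. R2 (WidthTwoStandard): every homotopy 4-sphere with w(Σ)
≤ 2 is diffeomorphic to S⁴.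
E2 (WidthTwoExists): every homotopy 4-sphere has w(Σ) ≤ 2. The informative rung R1
(WidthOneStandard: w ≤ 1 ⇒ S⁴, i.e. "a fake
4-sphere cannot be swept out by S³'s, S¹×S²'s and lens spaces") is filed UNCONDITIONALLY as the
special case of R2 (its proof plan
consumes Property R and Laudenbach–Poenaru as named Literature inputs, no longer as hypotheses of
the signature — route-repair
2026-08-15, cone hygiene); it is not load-bearing for the deciding theorem.
Lean: `WidthTwoStandard ∧ WidthTwoExists`

## Assembly
DECIDING THEOREM (D-0027 §2.1): `theorem closes (hR2 : WidthTwoStandard) (hE2 : WidthTwoExists) :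
SmoothPoincare4` — pure logic plus the
packaging of a bare `M ≃ₕ S⁴` as a `HomotopySphere 4`: unfold SmoothPoincare4 to its binders, get
`CompactSpace M` and an orientation `o`
from the two PROVED tree theorems `compactSpace_of_homotopyEquiv_sphere_four_holds` and
`isOrientable_of_homotopyEquiv_sphere_four_holds`
(imports HomotopyS4CompactProofs, HomotopyS4OrientableProofs), build S := ⟨M, o, ⟨e⟩⟩, take the
width-2 sweepout from E2 and feed it to R2
(axioms propext / Classical.choice / Quot.sound; certified with `ledger route check --native`,
2026-08-15). The optional item
`Assembly := WidthTwoStandard → WidthTwoExists → SmoothPoincare4` is the same implication as a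
statement (provable now by
`fun h₁ h₂ => closes h₁ h₂`); `widthOne_of_widthTwo : WidthTwoStandard → WidthOneStandard` (1 ≤ 2)
is machine-checked in the planner sketch.

Rationale: WHY THIS LINE. Crossing one critical value of a generic Morse function on Σ⁴ changes the regular
level by one move on closed 3-manifolds (index 1:
Y ↦ Y # S¹×S² or joining components; index 2: integral Dehn surgery on a framed knot; indices 3, 4:
the inverses), so f is a closed
walk from ∅ to ∅ in the integral Dehn-surgery graph, and on a HOMOTOPY sphere Mayer–Vietoris plus
duality at every level (Hantzsche
doi:10.1007/bf01181085, Kawauchi–Kojima doi:10.1007/bf01457818: Tor H₁(level) ≅ G ⊕ G, sides of an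
S³-level are homology balls,
sides of an S¹×S²-level have (H₁,H₂) = (ℤ,0)|(0,ℤ)) prunes the walk: no lens space is ever a level,
a 2-handle leaving an S³-level is a
0-framed knot with S¹×S² surgery (unknot, GabaiJDG1987 = tree `isUnknot_of_isIntegralSurgery_zero`),
a 2-handle leaving an
S¹×S²-level from its (ℤ,0) side is a winding-one knot with an S³ surgery (a core, Gabai +
Gluck/LaudenbachPoenaru1972 = tree
`exists_diffeomorph_comp_incl_eq`), and every legal genus-≤1 move is one half of a geometrically
cancelling pair — rung 1 closes by
handle cancellation and Γ₄ = 0. Imported area: geometrisation-era 3-manifold topology (Dehn-surgery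
rigidity, Heegaard genus,
linking forms) applied to the ℝ¹-column of auxiliary maps, which no prior route uses (NoOneHandles
counts index-1 points,
GroupTrisection grades the central surface of a Morse 2-function, WrinkleUnlinking maps to S⁴); the
grading strictly contains the
trisection grading (w ≤ g_tris — comparison lemma WidthLeTrisectionGenus, deferred, see NOT
DECOMPOSED YET — so rung 2 ⊋ MeierZupan2017) and rung 2 already contains every
twisted double C ∪_φ C̄ of a Mazur-type contractible C with genus-2 boundary (AkbulutKirby1979 Mazur
manifolds,
doi:10.1307/mmj/1029002261), far outside any trisection-genus bound. Negatives index empty at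
filing.

RANKED CRUXES. #0 Target (target) — X = R2 ∧ E2 (Lean: the two crux bodies inlined verbatim — the
same Prop as `WidthTwoStandard ∧ WidthTwoExists` by Iff.rfl — because the gate writes Target before
the decls it would name): every homotopy 4-sphere admits a Morse function with distinct critical
values all of whose regular levels carry a Morse function with ≤ 2 index-1 critical points
(level-genus width ≤ 2), and every homotopy 4-sphere admitting one is diffeomorphic to S⁴. (why it
might fail: X ⟺ SPC4 (the height function of S⁴ has width 0): it fails iff an exotic 4-sphere exists
— one of width ≤ 2 kills R2, one of width ≥ 3 kills E2, and E2 has no slack beyond SPC4 itself.)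
[Kirby1997, FreedmanGompfMorrisonWalker2010, MeierZupan2017, doi:10.1307/mmj/1029002261]
#2 WidthTwoStandard (crux) — (R2, card item R2) for every homotopy 4-sphere S and every Morse f : S
→ ℝ injective on its critical set, if every regular level RegularLevel h (h : IsRegularLevel (𝓡 4) f
t) carries a Morse function g with (criticalSetOfIndex (𝓡 3) g 1).ncard ≤ 2 — i.e. total Heegaard
genus ≤ 2: levels among S³, S¹×S², S¹×S² # S¹×S², L(p,q) # L(p,q') with hyperbolic linking form,
genus-2 Seifert/hyperbolic manifolds with Tor H₁ = G ⊕ G, and disjoint unions of total genus ≤ 2 —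
then S ≅ S⁴. [difficulty: open-problem] (why it might fail: Width 2 contains every twisted double C
∪_φ C̄ of a Mazur-type contractible C with genus-2 boundary (cork twists included) and 2-fold covers
of 2-knots with 3-bridge cross-sections; one exotic member refutes it (and SPC4); genus-2 surgery
transitions have no classification engine.) [doi:10.1307/mmj/1029002261, GabaiNaylorSchwartz2025,
MeierZupan2017, AitchisonRubinstein1984, GabaiJDG1987]
#3 WidthOneStandard (crux) — (R1, card rung 1; the special case w ≤ 1 of R2, `WidthTwoStandard →
WidthOneStandard` by 1 ≤ 2) UNCONDITIONAL since the 2026-08-15 repair (the former hypotheses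
`[SphereEmbedding.SmoothnessFacts]`, `isUnknot_of_isIntegralSurgery_zero`,
`exists_diffeomorph_comp_incl_eq.{0}` left the signature so that the route cone carries no unproved
Literature Prop; they remain the named inputs of the proof): a homotopy 4-sphere carrying a Morse
function with distinct critical values all of whose regular levels have total Heegaard genus ≤ 1 is
diffeomorphic to S⁴. Proof plan: (H) Mayer–Vietoris/duality automaton — no lens-space level
(Hantzsche), legal moves = 1-handles joining components or S³ ↦ S¹×S², 0-framed unknot (Property R,
GabaiJDG1987 Cor 8.3 = tree fact `isUnknot_of_isIntegralSurgery_zero`), core of S¹×S² from the (ℤ,0)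
side (Gabai + Gluck), 3-handles along separating spheres or pt×S² from the (0,ℤ) side
(Laudenbach1973), final gluing by Laudenbach–Poenaru (tree fact `exists_diffeomorph_comp_incl_eq`; k
= 0 is Cerf Γ₄ = 0) — each half of a geometrically cancelling pair, so sublevel sets are
boundary-sum trees of B⁴, S¹×B³, S²×D², S³×I blocks and Σ = B⁴ ∪_φ B⁴ ≅ S⁴. Expected first landing:
the CONDITIONAL theorem `isUnknot_of_isIntegralSurgery_zero → exists_diffeomorph_comp_incl_eq.{0} →
WidthOneStandard` in Theorems under `--supports WidthOneStandard`; the item closes when the two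
facts carry `_holds`. [difficulty: XL — L modulo the two facts] (why it might fail: as stated it
silently contains Property R and Laudenbach–Poenaru, so it is unclosable until both are formalised;
encoding risks — a legal genus-≤1 move missed by automaton (A) at DISCONNECTED levels,
ncard/empty-level junk; the mathematics should hold.) [GabaiJDG1987, LaudenbachPoenaru1972,
Laudenbach1973, Cerf1968, doi:10.1007/bf01181085, doi:10.1007/bf01457818,
doi:10.32917/hmj/1147883401]
#4 WidthTwoExists (crux) — (E2, card item EXIST(2), the ceiling of the ladder) every homotopy
4-sphere admits a Morse function with pairwise distinct critical values each of whose regular levels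
carries a Morse function with at most 2 critical points of index 1 (level-genus width ≤ 2).
[difficulty: open-problem] (why it might fail: SPC4-hard with zero slack: given R2 it is equivalent
to SPC4, and no construction lowers the width of a given sweepout (thin position has no
4-dimensional thinning move); an exotic sphere of width ≥ 3 — e.g. one needing T³ or genus-3 levels
in every sweepout — refutes it.) [Kirby1997, zbl:0818.57013, doi:10.1073/pnas.1718953115,
MeierSchirmerZupan2016]
#1 Assembly (assembly) — WidthTwoStandard → WidthTwoExists → SmoothPoincare4, the statement form of
the deciding theorem `closes` (kept; provable now). No support item is filed after the 2026-08-15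
repair: the former #9 WidthLeTrisectionGenus (w ≤ g_tris, stmt-SmoothPoincare4-7584) is deferred,
see NOT DECOMPOSED YET.

TWO-LAYER PLAN. Foreseen glued splits (not filed): WidthOneStandard ⇐ HomologicalAutomaton (every
regular level component of a width-1 sweepout is S³
or S¹×S² and every critical value is one of the four legal moves of (A)) → GeometricCancellation (a
generic Morse function all of
whose moves are legal presents Σ as B⁴ ∪_φ B⁴) → WidthOneStandard (k = 2). WidthTwoStandard ⇐
HyperellipticDescent (a width-2
sweepout whose surgery transitions are strongly invertible for compatible hyperelliptic involutions
— Birman–Hilden on genus-≤2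
levels, Montesinos' trick at each 2-handle — is the 2-fold branched cover of S⁴ over a 2-knot with
≤3-bridge cross-sections) →
ThinTwoKnotCoversStandard (such covers that are homotopy spheres are S⁴; contains twisted Mazur
doubles as Σ₂(B⁴, D ∪_φ D'),
Akbulut–Kirby) → TunnelTwoResidue (the non-invertible genus-2 transitions) → WidthTwoStandard (k =
3). WidthTwoExists: no split
foreseen (SPC4-strength).

KILL CRITERIA. Either load-bearing crux is a consequence of SPC4, so a refutation of
WidthTwoStandard (an exotic width-2 sphere — most plausibly a
twisted Mazur double or a bridge-thin 2-knot cover) or of WidthTwoExists settles the summit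
negatively: close `refuted:<Decl>` and hand
the witness to the negative routes (GluckLasagna / ZeroSurgeryExotic). WidthOneStandard refuted AS
STATED (an encoding defect: ncard
junk, empty levels, a missed disconnected-level move) forces a `--restate`, not a close;
WidthOneStandard found in print (Saeki 2006
HMJ 36, acq-01942, or a genus-one sequel) downgrades it to a cite/support item with the ladder
intact. Soft kill: if HyperellipticDescent
is shown false on a known-standard family with provably non-invertible transitions AND the genus-2
walk census yields no standardisation
pattern within one tenure round, park the route dormant behind NoOneHandles/GroupTrisection. SPC4
proved elsewhere moots it.

NOT DECOMPOSED YET. The homological lemma (H) (Mayer–Vietoris + Poincaré–Lefschetz duality + linking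
forms; Mathlib has singular homology but no duality
for manifolds with boundary) — requested as the cite fact "Hantzsche"; the classification of closed
3-manifolds of Heegaard genus ≤ 1
(S³, S¹×S², L(p,q) with |H₁| = p ≥ 2), Laudenbach's sphere theorem in S¹×S², Gabai's corollary for
knots in S¹×S² with an S³
surgery — cite facts, layer-2 inputs of WidthOneStandard; the Morse bookkeeping (level passage =
surgery is PROVED in the tree,
LevelPassageSurgery.lean; rearrangement/cancellation for "≤ k index-1 points ⟺ total Heegaard genus
≤ k"); the twisted-Mazur-double
special case of R2 as a typed item (needs double/cork vocabulary over `IsBoundaryGluing`); the finer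
gradings of the card (b₁-width,
torsion-width, Gromov-norm width, HF-rank width); the genus-2 legal-walk census (kit: Regina/SnapPy
level recognition with
(H)-pruning) — refuter/prover work under WidthTwoStandard. DEFERRED BY THE 2026-08-15 ROUTE-REPAIR
(D-0027 §2.1 staffability: no unproved Literature Prop in the cone of the items + `closes`): (a) the
trisection comparison — a closed smooth 4-manifold with a (g; k₁,k₂,k₃) Gay–Kirby trisection has
level-genus width ≤ g (former support item WidthLeTrisectionGenus, stmt-SmoothPoincare4-7584,
refuter-checked "plausible folklore", GayKirby2016 §4, MeierSchirmerZupan2016) — dropped only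
because its statement needs `IsGKTrisection`, i.e. `import
Literature.Topology.FourManifolds.Trisections`, whose module puts the unproved XL existence facts
`exists_isBalancedGKTrisection` / `exists_isBalancedTrisection` into the import cone; re-file it
verbatim (`ledger workitem add --kind statement --route route-SmoothPoincare4-LensThinSweepouts
--rank 9 --name WidthLeTrisectionGenus --signature <old signature>`) when a prover wants it or those
facts are discharged; (b) the CONDITIONAL rung-1 theorem `isUnknot_of_isIntegralSurgery_zero →
exists_diffeomorph_comp_incl_eq.{0} → WidthOneStandard` — now a Theorems-side milestone under
`--supports WidthOneStandard`, not the item signature. needs-fact (tier-0) declared: NONE — the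
deciding line (R2, E2, closes) uses only HomotopySpheres / Morse / RegularLevelSet vocabulary and
the two proved packaging theorems; R1's inputs `isUnknot_of_isIntegralSurgery_zero` (Gabai, XL) and
`exists_diffeomorph_comp_incl_eq` (Laudenbach–Poenaru, XL) stay ordinary Literature debt because R1
is not a hypothesis of `closes`. Imports after repair: HomotopySpheres, Morse, RegularLevelSet,
HomotopyS4CompactProofs, HomotopyS4OrientableProofs (SurgeryGluck, SPC4Handles, Trisections dropped:
11 of the 27 flagged import-cone facts rode in on them, the rest sit under the Statement's own
SPC4Wave0 import and RegularLevelSet → HCobordismHandles, shared by every SPC4 route and used by no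
item).

CHEAPEST FALSIFIER. (i) Hand-check automaton (A) against DISCONNECTED levels (one hour): list every
index-0..4 move between disjoint unions of S³'s and at
most one S¹×S² compatible with per-component duality, and confirm each is a birth/death, a
join/split of components, or one half of a
cancelling pair — done informally here (self-join of an S³×I block is excluded because its S³ level
would bound a side with H₁ = ℤ;
2-handles from the (0,ℤ) side and 3-handles from the (ℤ,0) side are excluded by H₂/H₃ of the sides);
a refuter should redo it.
(ii) Lookup: Saeki, Hiroshima Math. J. 36 (2006) doi:10.32917/hmj/1147883401 (sphere levels = width
0; acq-01942, not obtainable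
today) and any sequel on genus-one levels — a hit makes R1 `known`, not false. (iii) For R2: compute
the width of the standard
diagrams of the Gompf/Akbulut–Kirby presentation spheres and of Σ₂(τ_k K) for 2-bridge K; a width-≤2
sweepout of an AC-suspicious
sphere with non-invertible transitions kills the foreseen HyperellipticDescent split (R2 itself
stands).

NUMBERS. w(S⁴) = 0 (height function, all levels S³). Rung comparison: w(Σ) ≤ g_tris(Σ) (comparison
lemma, deferred), so rung r ⊇ trisection rung r;
trisection genus ≤ 2 ⇒ S⁴ (MeierZupan2017 Thm 1.2 / MeierSchirmerZupan2016 Thm 1.2; tree barrier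
`LowGenusTrisectionBarrier`),
first open trisection type (3;1,1,1). Genus-≤1 closed orientable 3-manifolds: S³, S¹×S², L(p,q) with
|H₁(L(p,q))| = p ≥ 2; Hantzsche:
a closed orientable Y³ ⊂ homology 4-sphere has Tor H₁(Y) ≅ G ⊕ G (doi:10.1007/bf01181085,
doi:10.1007/bf01457818), so no lens space
is a level. A twisted Mazur double C ∪_φ C̄ has a 6-critical-point sweepout S³, S¹×S², ∂C, S¹×S²,
S³, hence w ≤ g(∂C) (= 2 for
Brieskorn-sphere boundaries such as Σ(2,5,7)). Items at open: 6 (target, assembly, 3 cruxes, 1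
support); after the 2026-08-15 repair: 5 (target, assembly, 3 cruxes) + the deciding theorem
`closes`.

DEFINITION REQUESTS. No definition is needed to type the items: levels are
`Literature.Topology.FourManifolds.RegularLevel h` (RegularLevelSet.lean, with
its 𝓡 3 manifold instances) and "total Heegaard genus ≤ k" is encoded as "∃ Morse g on the level
with (criticalSetOfIndex (𝓡 3) g
1).ncard ≤ k" (finiteness of the critical set is the proved `IsMorse.finite_criticalSet_holds`).
Cite facts wanted (filed as
`--kind cite` items after open): Hantzsche's theorem (Tor H₁ ≅ G ⊕ G for closed orientable
3-manifolds smoothly embedded in a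
homology 4-sphere; doi:10.1007/bf01181085, doi:10.1007/bf01457818); Heegaard genus ≤ 1
classification (S³, S¹×S², lens spaces;
Schultens2014 / Rolfsen1976 §9.B); Laudenbach1973 (a non-separating smoothly embedded 2-sphere in
S¹×S² is isotopic to pt×S²).
WANTED (acquisition): doi:10.32917/hmj/1147883401 (Saeki 2006, acq-01942);
doi:10.2969/jmsj/1158241939 (Saeki–Suzuoka 2005).

Novelty: Searches (2026-08-15; local searchd and OpenAlex/arXiv legs unavailable this session, zbMATH and
Galaxy used): `lit search --source
zbmath` for "Morse functions sphere fibers" (6: Saeki 2006 doi:10.32917/hmj/1147883401, Kitazawa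
round fold maps), "special generic
maps homotopy 4-sphere" (1: Saeki–Suzuoka 2005 doi:10.2969/jmsj/1158241939), "Heegaard genus level
4-manifold Morse" (1, Isoshima–Ogawa
2024, trisections of Gluck twists — unrelated), "Morse functions lens space fibers" / "Morse
function regular levels lens spaces" /
"homotopy 4-sphere Morse function levels" / "thin position 4-manifold width Morse" (0 each),
"twisted double Mazur manifold 4-sphere"
(1: Fintushel–Stern 1981); `lit galaxy search --star all` for "Morse functions with sphere fibers",
"Heegaard genus of the fiber" (0
each) and "genus two imbeddings" (1: Kirby LNM 1374 citing Scharlemann 1984); `lit frontier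
SmoothPoincare4 --since 2021` (30 rows;
nearest: arXiv:2605.26337 branched coverings of simply connected 4-manifolds, arXiv:2603.23717
Dunfield–Gong sphere — none grades level
3-manifolds); `lit bridges SmoothPoincare4 --cross any` (noise); plus the card's and two refuter
audits' searches (Islambouli–Naylor
arXiv:2010.03057, Kirby–Thompson doi:10.1073/pnas.1718953115, Montesinos TAMS 245 (1978)
doi:10.2307/1998880, Hayano
doi:10.2140/agt.2011.11.1267).
Nearest prior art found: Scharlemann1984 (doi:10.1016/0040-9383(84)90040-5: the SAME grading one
dimension down — genus of the level
surfaces of a slice  [refs: 10.32917/hmj/1147883401, 10.2969/jmsj/1158241939, 10.1073/pnas.1718953115, 10.2307/1998880, 10.2140/agt.2011.11.1267, 10.1016/0040-9383(84, 2605.26337, 2603.23717, 2010.03057, doi:10.32917/hmj/1147883401, doi:10.2969/jmsj/1158241939, doi:10.1073/pnas.1718953115, doi:10.2307/1998880, doi:10.2140/agt.2011.11.1267, doi:10.1016/0040-9383, Scharlemann1984, MeierZupan2017, MeierSchirmerZupan2016]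

Barriers (technique_class: level-set-3-manifold-width, dehn-surgery-rigidity): - technique_class: level-set-3-manifold-width, dehn-surgery-rigidity
- Literature.Barriers.SmoothPoincare4.LowGenusTrisectionBarrier: a different and coarser-indexed
filtration — WidthLeTrisectionGenus gives w ≤ g_tris, so width-rung r CONTAINS trisection-rung r
(and the MSZ large-k range, `LargeKTrisectionBarrier` of the same file); R1 is not implied by
Meier–Schirmer–Zupan (a width-1 sweepout may have a hundred critical points) and R2 strictly exceeds
genus-2 trisections (all twisted Mazur doubles with genus-2 boundary); the barrier marks solved
territory inside our rungs, it does not bound them — our levels are closed 3-manifolds of a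
1-function, not sectors of a 2-function.
- Literature.Barriers.SmoothPoincare4.PropertyTwoRBarrier: R1 uses Property R for ONE component only
(n = 1, Gabai) and concludes by geometric cancellation read off the level isotopy class; no filed
item asserts slide-triviality of an R-link (same for `StrictPropertyTwoRBarrier`). Rung 2 does
contain 1-handle-free presentations with two 0-framed 2-handles on an R-link whose intermediate
level S³_0(K₁) has genus ≤ 2 (levels S³, S³_0(K₁), S¹×S² # S¹×S²), so thin GST-type examples fall
inside R2: there the bet is the 4-manifold conclusion (weak GPRC with Hopf pairs, which destroys the
Andrews–Curtis class, GompfScharlemannThompson2010 Prop 9.2), exactly as for NoOneHandles' C2 — the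
barrier's named obstruction (AC-nontriviality of the GST presentations) constrains link calculus,
not the diffeomorphism typ

Novelty grade: new-combination — ROUTE REVIEW (refuter rreview 935e0e2b, 2026-08-15T14Z). CONFORMS: Assembly = WidthTwoStandard → WidthTwoExists → SmoothPoincare4 decides the summit (D-0027 OK). MATERIALISATION BUG: Theses/LensThinSweepouts.lean does not exist (rev 0) because the gate processed Target/Assembly before the sibling de (refuter refuter-rreview-route-SmoothPoincare4-Le-935e0e2b-0, 2026-08-15T14:04:40Z; prior: doi:10.32917/hmj/1147883401,Scharlemann1984,zbl:0818.57013,MeierZupan2017,doi:10.4099/math1924.28.287,doi:10.1016/j.topol.2017.11.037)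

History (route lifecycle, newest last):
- 2026-08-15T16:25:18Z · rev 1: restated Target (stmt-SmoothPoincare4-7580), WidthOneStandard (stmt-SmoothPoincare4-7582) — route-repair (rbadge g4; glue.missing + cone guardrail): (1) DECIDING THEOREM `closes (hR2 : WidthTwoStandard) (hE2 : WidthTwoExists) : _root_.SmoothPoincare4` (planner-rbadge-SmoothPoincare4-LensThinSweepou-ca4b47ee-g4-0)
- 2026-08-15T16:25:18Z · rev 1: dropped stmt-SmoothPoincare4-7584 — route-repair (rbadge g4; glue.missing + cone guardrail): (1) DECIDING THEOREM `closes (hR2 : WidthTwoStandard) (hE2 : WidthTwoExists) : _root_.SmoothPoincare4` (planner-rbadge-SmoothPoincare4-LensThinSweepou-ca4b47ee-g4-0)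
- 2026-08-22T14:21:37Z · DORMANT — reconciler: no traction for 5.4 d (last activity item-evidence-added at 2026-08-17T04:13:38Z); parked, not closed — `ledger route dormant route-SmoothPoincare4- (operator:999:3963559)

sub-problem: SmoothPoincare4 · status: dormant · opened planner-plancard-SmoothPoincare4-SmoothPoinca-40ce6ae4-0 2026-08-15T12:12:08Z · rev 1 · ledger route-SmoothPoincare4-LensThinSweepouts
GENERATED by the gate from the ledger (D-0016/17). Provers cite these decls: `theorem foo : Summit.SmoothPoincare4.SmoothPoincare4.Theses.LensThinSweepouts.<Decl> := …` in Summits/SmoothPoincare4/SmoothPoincare4/Theorems/<Name>.lean.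
-/

namespace Summit.SmoothPoincare4.SmoothPoincare4.Theses.LensThinSweepouts

open scoped BigOperators Topology Manifold Classical MeasureTheory ProbabilityTheory Matrix InnerProductSpace ComplexConjugate ContinuousMap ContDiff
open Filter Set Function TopologicalSpace MeasureTheory

attribute [summit_statement] _root_.SmoothPoincare4

open Literature.SPC4

-- earlier Target (stmt-SmoothPoincare4-7580, replaced 2026-08-15T16:25:18Z -> stmt-SmoothPoincare4-10851): retired by None — WidthTwoStandard ∧ WidthTwoExists
/-- item stmt-SmoothPoincare4-10851 · target · rank 0 · open · by planner
why it might fail: X ⟺ SPC4 (the height function of S⁴ has width 0): it fails iff an exotic 4-sphere exists — one of width ≤ 2 kills R2, one of width ≥ 3 kills E2, and E2 has no slack beyond SPC4 itself.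
sources: Kirby1997, FreedmanGompfMorrisonWalker2010, MeierZupan2017, doi:10.1307/mmj/1029002261
[target] X = R2 ∧ E2: every homotopy 4-sphere admits a Morse function with distinct critical values
all of whose regular levels carry a Morse function with ≤ 2 index-1 critical points (level-genus
width ≤ 2), and every homotopy 4-sphere admitting one is diffeomorphic to S⁴. (Restated 1:1 on
2026-08-15 with the two crux bodies inlined verbatim — the same Prop as `WidthTwoStandard ∧
WidthTwoExists` by Iff.rfl — because the gate writes Target before the decls it named; blocked at
open for that reason only.) -/
@[route_item "route-SmoothPoincare4-LensThinSweepouts"]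
def Target : Prop :=
  (∀ (S : Literature.Topology.FourManifolds.HomotopySphere 4) (f : S.carrier → ℝ), Literature.Topology.FourManifolds.IsMorse (𝓡 4) f → Set.InjOn f (Literature.Topology.FourManifolds.criticalSet (𝓡 4) f) → (∀ (t : ℝ) (h : Literature.Topology.FourManifolds.IsRegularLevel (𝓡 4) f t), ∃ g : Literature.Topology.FourManifolds.RegularLevel h → ℝ, Literature.Topology.FourManifolds.IsMorse (𝓡 3) g ∧ (Literature.Topology.FourManifolds.criticalSetOfIndex (𝓡 3) g 1).ncard ≤ 2) → Nonempty (S.carrier ≃ₘ⟮𝓡 4, 𝓡 4⟯ Metric.sphere (0 : EuclideanSpace ℝ (Fin 5)) 1)) ∧ (∀ S : Literature.Topology.FourManifolds.HomotopySphere 4, ∃ f : S.carrier → ℝ, Literature.Topology.FourManifolds.IsMorse (𝓡 4) f ∧ Set.InjOn f (Literature.Topology.FourManifolds.criticalSet (𝓡 4) f) ∧ ∀ (t : ℝ) (h : Literature.Topology.FourManifolds.IsRegularLevel (𝓡 4) f t), ∃ g : Literature.Topology.FourManifolds.RegularLevel h → ℝ, Literature.Topology.FourManifolds.IsMorse (𝓡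 3) g ∧ (Literature.Topology.FourManifolds.criticalSetOfIndex (𝓡 3) g 1).ncard ≤ 2)

/-- item stmt-SmoothPoincare4-7581 · crux · rank 2 · open · by planner
why it might fail: Width 2 contains every twisted double C ∪_φ C̄ of a Mazur-type contractible C with genus-2 boundary (cork twists included) and 2-fold covers of 2-knots with 3-bridge cross-sections; one exotic member refutes it (and SPC4); genus-2 surgery transitions have no classification engine.
sources: doi:10.1307/mmj/1029002261, GabaiNaylorSchwartz2025, MeierZupan2017, AitchisonRubinstein1984, GabaiJDG1987
[crux] (R2, card item R2) for every homotopy 4-sphere S and every Morse f : S → ℝ injective on its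
critical set, if every regular level RegularLevel h (h : IsRegularLevel (𝓡 4) f t) carries a Morse
function g with (criticalSetOfIndex (𝓡 3) g 1).ncard ≤ 2 — i.e. total Heegaard genus ≤ 2: levels
among S³, S¹×S², S¹×S² # S¹×S², L(p,q) # L(p,q') with hyperbolic linking form, genus-2
Seifert/hyperbolic manifolds with Tor H₁ = G ⊕ G, and disjoint unions of total genus ≤ 2 — then S ≅
S⁴. [difficulty: open-problem] -/
@[route_item "route-SmoothPoincare4-LensThinSweepouts", crux]
def WidthTwoStandard : Prop :=
  ∀ (S : Literature.Topology.FourManifolds.HomotopySphere 4) (f : S.carrier → ℝ), Literature.Topology.FourManifolds.IsMorse (𝓡 4) f → Set.InjOn f (Literature.Topology.FourManifolds.criticalSet (𝓡 4) f) → (∀ (t : ℝ) (h : Literature.Topology.FourManifolds.IsRegularLevel (𝓡 4) f t), ∃ g : Literature.Topology.FourManifolds.RegularLevel h → ℝ, Literature.Topology.FourManifolds.IsMorse (𝓡 3) g ∧ (Literature.Topology.FourManifolds.criticalSetOfIndex (𝓡 3) g 1).ncard ≤ 2) → Nonempty (S.carrier ≃ₘ⟮𝓡 4, 𝓡 4⟯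 Metric.sphere (0 : EuclideanSpace ℝ (Fin 5)) 1)

-- earlier WidthOneStandard (stmt-SmoothPoincare4-7582, replaced 2026-08-15T16:25:18Z -> stmt-SmoothPoincare4-10852): retired by None — ∀ [Literature.Topology.FourManifolds.SphereEmbedding.SmoothnessFacts], Literature.Topology.FourManifolds.isUnknot_of_isIntegralSurgery_zero → Literature.Topology.FourManifolds.exists_diffeomorph_comp_incl_eq.{0} → ∀ (S : Literature.Topology.FourManifolds.HomotopySphe
/-- item stmt-SmoothPoincare4-10852 · crux · rank 3 · open · by planner
why it might fail: As stated it silently contains Property R (Gabai) and Laudenbach–Poenaru, so it is unclosable until both are formalised; encoding risks: a legal genus-≤1 move missed by automaton (A) at DISCONNECTED levels, ncard/empty-level junk. The mathematics should hold.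
sources: GabaiJDG1987, LaudenbachPoenaru1972, Laudenbach1973, Cerf1968, doi:10.1007/bf01181085, doi:10.1007/bf01457818
[crux] (R1, card rung 1 — the special case w ≤ 1 of R2; `WidthTwoStandard → WidthOneStandard` by 1 ≤
2, machine-checked) UNCONDITIONAL form (route-repair 2026-08-15: the former hypotheses
`[SphereEmbedding.SmoothnessFacts]`, `isUnknot_of_isIntegralSurgery_zero`,
`exists_diffeomorph_comp_incl_eq.{0}` were removed from the signature so that the route cone carries
no unproved Literature Prop; they remain the named INPUTS of the proof plan): a homotopy 4-sphere
carrying a Morse function with pairwise distinct critical values all of whose regular levels carry a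
Morse function with ≤ 1 index-1 critical point (total Heegaard genus ≤ 1: level components among S³,
S¹×S², lens spaces) is diffeomorphic to S⁴. Proof plan: (H) Mayer–Vietoris/duality automaton — no
lens-space level (Hantzsche), legal moves = 1-handles joining components or S³ ↦ S¹×S², 0-framed
unknot (Property R = tree fact `isUnknot_of_isIntegralSurgery_zero`, GabaiJDG1987 Cor 8.3), core of
S¹×S² from the (ℤ,0) side (Gabai + Gluck), 3-handles along separating spheres or pt×S² from the
(0,ℤ) side (Laudenbach1973), final gluing by Laudenbach–Poenaru (tree fact
`exists_diffeomorph_comp_incl_eq`; k = 0 is Cerf Γ₄ = 0) — each half o -/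
@[route_item "route-SmoothPoincare4-LensThinSweepouts"]
def WidthOneStandard : Prop :=
  ∀ (S : Literature.Topology.FourManifolds.HomotopySphere 4) (f : S.carrier → ℝ), Literature.Topology.FourManifolds.IsMorse (𝓡 4) f → Set.InjOn f (Literature.Topology.FourManifolds.criticalSet (𝓡 4) f) → (∀ (t : ℝ) (h : Literature.Topology.FourManifolds.IsRegularLevel (𝓡 4) f t), ∃ g : Literature.Topology.FourManifolds.RegularLevel h → ℝ, Literature.Topology.FourManifolds.IsMorse (𝓡 3) g ∧ (Literature.Topology.FourManifolds.criticalSetOfIndex (𝓡 3) g 1).ncard ≤ 1) → Nonempty (S.carrier ≃ₘ⟮𝓡 4, 𝓡 4⟯ Metric.sphere (0 : EuclideanSpace ℝ (Fin 5)) 1)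

/-- item stmt-SmoothPoincare4-7583 · crux · rank 4 · open · by planner
why it might fail: SPC4-hard with zero slack: given R2 it is equivalent to SPC4, and no construction lowers the width of a given sweepout (thin position has no 4-dimensional thinning move); an exotic sphere of width ≥ 3 — e.g. one needing T³ or genus-3 levels in every sweepout — refutes it.
sources: Kirby1997, zbl:0818.57013, doi:10.1073/pnas.1718953115, MeierSchirmerZupan2016
[crux] (E2, card item EXIST(2), the ceiling of the ladder) every homotopy 4-sphere admits a Morse
function with pairwise distinct critical values each of whose regular levels carries a Morse
function with at most 2 critical points of index 1 (level-genus width ≤ 2). [difficulty: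
open-problem] -/
@[route_item "route-SmoothPoincare4-LensThinSweepouts", crux]
def WidthTwoExists : Prop :=
  ∀ S : Literature.Topology.FourManifolds.HomotopySphere 4, ∃ f : S.carrier → ℝ, Literature.Topology.FourManifolds.IsMorse (𝓡 4) f ∧ Set.InjOn f (Literature.Topology.FourManifolds.criticalSet (𝓡 4) f) ∧ ∀ (t : ℝ) (h : Literature.Topology.FourManifolds.IsRegularLevel (𝓡 4) f t), ∃ g : Literature.Topology.FourManifolds.RegularLevel h → ℝ, Literature.Topology.FourManifolds.IsMorse (𝓡 3) g ∧ (Literature.Topology.FourManifolds.criticalSetOfIndex (𝓡 3) g 1).ncard ≤ 2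

/-- item stmt-SmoothPoincare4-7585 · assembly · rank 1 · open · by planner
sources: Kirby1997, KervaireMilnor1963
[assembly] WidthTwoStandard → WidthTwoExists → SmoothPoincare4. -/
@[route_item "route-SmoothPoincare4-LensThinSweepouts"]
def Assembly : Prop :=
  WidthTwoStandard → WidthTwoExists → SmoothPoincare4

/-! D-0027 §2.1 — DECIDING THEOREM (planner-authored via `route open/edit --closes-file`; by planner-rbadge-SmoothPoincare4-LensThinSweepou-ca4b47ee-g4-0 2026-08-15T16:25:18Z):
its hypotheses are this route's items and its conclusion the sub-problem Statement (glue_lint), and it elaborates with this file. -/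

@[closes "route-SmoothPoincare4-LensThinSweepouts"] theorem closes (hR2 : WidthTwoStandard) (hE2 : WidthTwoExists) : _root_.SmoothPoincare4 := by
  intro M _ _ _ _ _ e
  haveI : CompactSpace M :=
    Literature.Topology.FourManifolds.compactSpace_of_homotopyEquiv_sphere_four_holds M e
  obtain ⟨o⟩ :=
    Literature.Topology.FourManifolds.isOrientable_of_homotopyEquiv_sphere_four_holds M e
  obtain ⟨f, hf, hinj, hlev⟩ := hE2 ⟨M, o, ⟨e⟩⟩
  exact hR2 ⟨M, o, ⟨e⟩⟩ f hf hinj hlev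

end Summit.SmoothPoincare4.SmoothPoincare4.Theses.LensThinSweepouts
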